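import Literature.IUT.LogThetaLattice.PacketLogVolumesHaarModelRelativeTensor
import Literature.IUT.LogThetaLattice.PacketLogVolumesHaarModelRelLocalArch
import HarnessLib

/-!
# [IUTchIII] Remark 3.1.1 (ii) at the ARCHIMEDEAN packet, BY NAME: the weights of the genuine Haar models
# (absolute `K = F_mod` and relative `K ⊋ F_mod`, `|A| = 1` and `|A| ≥ 2`) are abc-iut-L6-t4's verbatim
# `packetWeight` / `packetWeightTensor` times the packet-normalisation factor `[K_{v̲}:ℝ]` of Prop. 3.9 (i) p. 116
# (abc-iut cell, layer L6; rows CAP39/REL39, the `∞`-junction split-off; closes audit INFO-2 on p421698)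

S. Mochizuki, *Inter-universal Teichmüller theory III*, kurims manuscript (May 2020), §3 [claim: Mochizuki2012,
status: disputed]. Remark 3.1.1 (ii), p. 94: "the normalized weight `1/([K_v : (F_mod)_v]·(Σ_{𝕍_mod ∋ w | v_ℚ}
[(F_mod)_w : ℚ_{v_ℚ}]))` … when we consider log-volumes on the portion of `log(^A𝓕_{v_ℚ})` corresponding to the
tensor product of various `K_{v_α}`, where `𝕍 ∋ v_α | v_ℚ` … the normalized weight
`1/((∏_{α∈A}[K_{v_α}:(F_mod)_{v_α}])·{Σ_{{w_α}_{α∈A}} ∏_{α∈A}[(F_mod)_{w_α}:ℚ_{v_ℚ}]})`"; these displays are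
stated for EVERY `v_ℚ ∈ 𝕍_ℚ`, the archimedean `v_ℚ = ∞` included (`ℚ_∞ = ℝ`, `[(F_mod)_w : ℝ] ∈ {1, 2}`).
Proposition 3.9 (i), p. 116 (archimedean `v_ℚ`): "the sum of the radial log-volumes on each of the direct summand
complex archimedean fields … together with the discussion of normalized weights in Remark 3.1.1, (ii), (iii), (iv)
… normalized so that multiplication … by `e = 2.71828...` corresponds to adding the quantity `1 = log(e) ∈ ℝ`;
we shall refer to this normalization as the packet-normalization."

WHAT THIS FILE ADDS. abc-iut-L6-t4's `PacketWeights.lean` types the two displays VERBATIM over an abstract index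
type `W` of places over `v_ℚ` with degrees `degF w = [(F_mod)_w : ℚ_{v_ℚ}]`, `degKF w = [K_v : (F_mod)_v]`
(`packetWeight`, `packetWeightTensor`). The genuine Haar models of [IUTchIII] Prop. 3.9 — abc-iut-L6-d3's
`haarWeight F` / `portionWeight F A` (`K = F_mod = F`, p415871 / p419250) and the relative family `relHaarWeight F K`
(abc-iut-L6-t5 p421193, abc-iut-w5-d030 p421404, abc-iut-w5-d004 p421634, abc-iut-w5-d083 p421698) — state their
junction with these printed weights BY NAME only at the FINITE `v_ℚ = p`
(`portionWeight_prime_eq_packetWeightTensor_mul`, `portionWeight_prime_eq_packetWeightTensor_rel_mul`; the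
`|A| = 1` finite weight as a literal display, `relHaarWeight_inr_eq_print`). At `v_ℚ = ∞` the models carry the
weight `[K_{v̲}:ℝ]/([K_{v̲}:F_v]·[F:ℚ])` and the cancellation against d3's absolute weight was recorded
(`relHaarWeight_inl_eq`), but the junction with the printed display — whose denominator at `∞` is
`Σ_{w|∞}[(F_mod)_w : ℝ]`, resp. `Σ_{(w_α)} ∏_α [(F_mod)_{w_α} : ℝ]` — was not restated, neither for `|A| = 1` nor for
`|A| ≥ 2` (second-reader note INFO-2 of abc-iut-w5-d002 on p421698, 2026-08-26). This PROOF-ONLY file states it,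
for all four archimedean cases and, for completeness of the by-name table, the two finite `|A| = 1` cases:
* `sum_mult_real` / `sum_prod_mult_eq_pow`: `Σ_{w|∞}[F_w:ℝ] = [F:ℚ]` (Mathlib `InfinitePlace.sum_mult_eq`) and
  `Σ_{(w_α)}∏_α[F_{w_α}:ℝ] = [F:ℚ]^{|A|}` (t4's `sum_prod_degF_eq_pow`) — the archimedean denominators;
* (a) `haarWeight_inl_eq_packetWeight_mul`: d3's `[F_w:ℝ]/[F:ℚ]` **is** `packetWeight([F_·:ℝ], 1)(w)·[F_w:ℝ]`, and
  `haarWeight_inl_eq_print`: `= [F_w:ℝ]/Σ_{w'|∞}[F_{w'}:ℝ]`;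
* (b) `relHaarWeight_inl_eq_print'`: the relative archimedean weight at ANY `w ∈ 𝕍(K)^arc` is
  `[K_w:ℝ]/([K_w:F_v]·Σ_{w'|∞}[F_{w'}:ℝ])` — Rmk. 3.1.1 (ii)'s first display VERBATIM times the packet-normalisation
  factor `[K_w:ℝ]`; along a lift `τ` of the archimedean places, `relHaarWeight_inl_eq_packetWeight_rel_mul`:
  `= packetWeight([F_·:ℝ], [K_{τ(·)}:F_·])(v)·[K_{τ v}:ℝ]` BY NAME;
* the archimedean tower law along a section `relLocalDegree_inl_section_mul_mult`:
  `[K_{τ v}:ℝ] = [K_{τ v}:F_v]·[F_v:ℝ]` when `(τ v)|_F = v` (w5-d030's `relLocalDegree_inl_mul_mult_comap`);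
* (c) `portionWeight_infty_eq_packetWeightTensor_mul`: for a tuple `π = (w_α)_α` of archimedean places of
  `F = F_mod`, d3's `∏_α [F_{w_α}:ℝ]/[F:ℚ]` **is** `packetWeightTensor([F_·:ℝ], 1)(π)·∏_α[F_{w_α}:ℝ]`;
* (d) `portionWeight_infty_eq_packetWeightTensor_rel_mul`: at the RELATIVE `A`-packets of p421698 (portions
  `⊗_{α,ℝ} K_{τ(w_α)}` weighted by the SAME `portionWeight F A ∞ π`), `portionWeight F A ∞ π =
  packetWeightTensor([F_·:ℝ], [K_{τ(·)}:F_·])(π)·∏_α[K_{τ(w_α)}:ℝ]` — the factors `[K_{v̲_α}:(F_mod)_{v_α}]` of the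
  third display cancel against the packet-normalisation factors `[K_{v̲_α}:ℝ] = [K_{v̲_α}:F_{v_α}]·[F_{v_α}:ℝ]`
  exactly as at `p` (where `[K_{v̲}:ℚ_p] = [K_{v̲}:F_v]·[F_v:ℚ_p]`, d083's `localDegree_lift_eq_mul`). This is the
  `|A| ≥ 2` archimedean junction asked for by INFO-2;
* (e) `haarWeight_inr_eq_packetWeight`, `relHaarWeight_inr_eq_packetWeight_rel`: the finite `|A| = 1` weights
  `1/[F:ℚ]`, `1/([K_{v̲}:F_v]·[F:ℚ])` are `packetWeight(n, 1)(v)`, `packetWeight(n, [K_{σ(·)}:F_·])(v)` BY NAME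
  (no extra factor: at a finite place the models' `log‖·‖_v` is the un-normalised Haar log-modulus of `F_v`).
So at every `v_ℚ ∈ 𝕍_ℚ`, every `|A|`, absolute or relative, `weight_model × μ^log_model` is, summand by summand,
the PRINTED weight of Remark 3.1.1 (ii) times the PRINTED (packet-normalised, un-averaged) log-volume.

DESIGN. Proof-only: no definition is introduced. The printed degrees enter t4's `ℕ+`-valued slots as the
inline families `w ↦ ⟨[F_w:ℝ], _⟩ = ⟨w.mult, InfinitePlace.mult_pos⟩` and `v ↦ ⟨[K_{τ v}:F_v], _⟩ =
⟨relLocalDegree F K (inl (τ v)), relLocalDegree_pos⟩` (t5's `relLocalDegree` at an archimedean place is campaign-S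
`pullbackWeight ∈ {1, 2}`); at `p` the existing `localDegreePNat` (d3) and `relLocalDegreePNat` (d083) are used.

HONEST SCOPE. Bookkeeping of weights only (classical: `Σ_{w|∞}[F_w:ℝ] = [F:ℚ]`, `[K_w:ℝ] = [K_w:F_v]·[F_v:ℝ]`);
nothing here constructs `(†𝓕⊛_mod)_α`, touches a log-volume, asserts anything about [IUTchIII] Cor. 3.12, or
takes a side; typed ≠ endorsed. Node IUTchIII:Prop3.9(iii) (rows CAP39/REL39, faithfulness-to-print junction).
-/

noncomputable section

namespace Literature.IUT.LogThetaLattice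

open Literature.IUT.LogVolume Literature.NumberTheory.NumberFields NumberField IsDedekindDomain

variable (F K : Type) [Field F] [NumberField F] [Field K] [NumberField K] [Algebra F K]

/-! ### The archimedean denominators of Remark 3.1.1 (ii): `Σ_{w|∞}[F_w:ℝ]` and `Σ_{(w_α)}∏_α[F_{w_α}:ℝ]` -/

/-- **`Σ_{𝕍_mod ∋ w | ∞} [(F_mod)_w : ℝ] = [F_mod : ℚ]`** (Mathlib `InfinitePlace.sum_mult_eq`, cast to `ℝ`): the
denominator of Remark 3.1.1 (ii)'s first display at `v_ℚ = ∞`. [claim: Mochizuki2012, status: disputed] -/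
theorem sum_mult_real : (∑ w : InfinitePlace F, (w.mult : ℝ)) = Module.finrank ℚ F := by
  exact_mod_cast InfinitePlace.sum_mult_eq (K := F)

/-- **`Σ_{(w_α)_{α∈A}} ∏_α [(F_mod)_{w_α} : ℝ] = [F_mod : ℚ]^{|A|}`**: the denominator of Remark 3.1.1 (ii)'s third
display at `v_ℚ = ∞` (the archimedean instance of abc-iut-L6-t4's `sum_prod_degF_eq_pow`).
[claim: Mochizuki2012, status: disputed] -/
theorem sum_prod_mult_eq_pow (A : Type) [Fintype A] [DecidableEq A] :
    (∑ w' : A → InfinitePlace F, ∏ a, ((w' a).mult : ℝ)) = (Module.finrank ℚ F : ℝ) ^ Fintype.card A := by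
  rw [← Fintype.prod_sum (fun (_ : A) (w : InfinitePlace F) => (w.mult : ℝ)), Finset.prod_const,
    Finset.card_univ, sum_mult_real]

/-! ### (a) `|A| = 1`, `K = F_mod`: d3's archimedean weight BY NAME -/

/-- **(a) `haarWeight F (inl w) = packetWeight([F_·:ℝ], 1)(w)·[F_w:ℝ]`**: abc-iut-L6-d3's archimedean weight
`[F_w:ℝ]/[F:ℚ]` IS Remark 3.1.1 (ii)'s normalized weight `1/([K_w:(F_mod)_w]·Σ_{w'|∞}[(F_mod)_{w'}:ℝ])` with
`K = F_mod` (abc-iut-L6-t4's `packetWeight`, `degKF = 1`) times the packet-normalisation factor `[F_w:ℝ]` of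
Prop. 3.9 (i) p. 116. [claim: Mochizuki2012, status: disputed] -/
theorem haarWeight_inl_eq_packetWeight_mul (w : InfinitePlace F) :
    haarWeight F (Sum.inl w) =
      packetWeight (fun w' : InfinitePlace F => (⟨w'.mult, InfinitePlace.mult_pos⟩ : ℕ+)) (fun _ => 1) w *
        (w.mult : ℝ) := by
  simp only [haarWeight_inl, packetWeight, PNat.mk_coe, PNat.one_coe, Nat.cast_one, one_mul, sum_mult_real F]
  rw [one_div, inv_mul_eq_div]

/-- **(a') VERBATIM at `∞`, `K = F_mod`**: `haarWeight F (inl w) = [F_w:ℝ]/Σ_{w'|∞}[F_{w'}:ℝ]`.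
[claim: Mochizuki2012, status: disputed] -/
theorem haarWeight_inl_eq_print (w : InfinitePlace F) :
    haarWeight F (Sum.inl w) = (w.mult : ℝ) / ∑ w' : InfinitePlace F, (w'.mult : ℝ) := by
  rw [haarWeight_inl, sum_mult_real]

/-! ### (b) `|A| = 1`, `K ⊋ F_mod`: the relative archimedean weight VERBATIM and BY NAME -/

omit [NumberField K] in
/-- **(b') VERBATIM at `∞`, relative case, at ANY archimedean place `w` of `K` over `v = w|_F`**:
`relHaarWeight F K (inl w) = [K_w:ℝ]/([K_w:F_v]·Σ_{𝕍_mod ∋ w' | ∞}[(F_mod)_{w'}:ℝ])` — Remark 3.1.1 (ii)'s first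
display `1/([K_v:(F_mod)_v]·Σ_{w'|v_ℚ}[(F_mod)_{w'}:ℚ_{v_ℚ}])` at `v_ℚ = ∞` times the packet-normalisation factor
`[K_w:ℝ]` (abc-iut-L6-t5's `relHaarWeight_inl` has `[F:ℚ]` in the denominator; `Σ_{w'|∞}[F_{w'}:ℝ] = [F:ℚ]`). The
archimedean companion of abc-iut-w5-d004's finite `relHaarWeight_inr_eq_print`. [claim: Mochizuki2012, status: disputed] -/
theorem relHaarWeight_inl_eq_print' (w : InfinitePlace K) :
    relHaarWeight F K (Sum.inl w) =
      (w.mult : ℝ) / (relLocalDegree F K (Sum.inl w) * ∑ w' : InfinitePlace F, (w'.mult : ℝ)) := by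
  rw [relHaarWeight_inl, sum_mult_real]

variable {F K}
variable (τ : InfinitePlace F → InfinitePlace K) (hτ : ∀ v, (τ v).comap (algebraMap F K) = v)

/-- **(b) `relHaarWeight F K (inl (τ v)) = packetWeight([F_·:ℝ], [K_{τ(·)}:F_·])(v)·[K_{τ v}:ℝ]`** along any lift
`τ : 𝕍(F_mod)^arc → 𝕍(K)^arc` of the archimedean places (the archimedean part of a section `𝕍_mod ⥲ V̲`, [IUTchI]
Def. 3.1 (e)): the relative archimedean weight IS abc-iut-L6-t4's `packetWeight` at `degF = [(F_mod)_·:ℝ]` and the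
GENUINE relative degrees `degKF(v) = [K_{τ v}:(F_mod)_v]` (t5's `relLocalDegree` = campaign-S `pullbackWeight`
`∈ {1,2}`), times the packet-normalisation factor `[K_{τ v}:ℝ]`. (No section property is needed for this identity.)
[claim: Mochizuki2012, status: disputed] -/
theorem relHaarWeight_inl_eq_packetWeight_rel_mul (v : InfinitePlace F) :
    relHaarWeight F K (Sum.inl (τ v)) =
      packetWeight (fun w' : InfinitePlace F => (⟨w'.mult, InfinitePlace.mult_pos⟩ : ℕ+))
          (fun v' : InfinitePlace F =>
            (⟨relLocalDegree F K (Sum.inl (τ v')), relLocalDegree_pos F K _⟩ : ℕ+)) v *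
        ((τ v).mult : ℝ) := by
  simp only [relHaarWeight_inl, packetWeight, PNat.mk_coe, sum_mult_real F]
  rw [one_div, inv_mul_eq_div]

omit [NumberField F] [NumberField K] in
include hτ in
/-- **The archimedean tower law along a section**: `[K_{τ v}:ℝ] = [K_{τ v}:F_v]·[F_v:ℝ]` when `(τ v)|_F = v`
(abc-iut-w5-d030's `relLocalDegree_inl_mul_mult_comap`, i.e. campaign-S `pullbackWeight_mul_mult_comap`) — the
archimedean analogue of d083's `localDegree_lift_eq_mul` (`[K_{v̲}:ℚ_p] = [K_{v̲}:F_v]·[F_v:ℚ_p]`).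
[claim: Mochizuki2012, status: disputed] -/
theorem relLocalDegree_inl_section_mul_mult (v : InfinitePlace F) :
    relLocalDegree F K (Sum.inl (τ v)) * v.mult = (τ v).mult := by
  have h := relLocalDegree_inl_mul_mult_comap F K (τ v)
  rwa [hτ v] at h

include hτ in
/-- Hence along a section the relative archimedean weight is d3's absolute one at the place below, now read as
`packetWeight([F_·:ℝ], [K_{τ(·)}:F_·])(v)·[K_{τ v}:ℝ] = packetWeight([F_·:ℝ], 1)(v)·[F_v:ℝ]` (the factor
`[K_{τ v}:F_v]` cancels; w5-d030's `relHaarWeight_inl_eq` in t4's vocabulary). [claim: Mochizuki2012, status: disputed] -/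
theorem packetWeight_rel_mul_eq_packetWeight_mul (v : InfinitePlace F) :
    packetWeight (fun w' : InfinitePlace F => (⟨w'.mult, InfinitePlace.mult_pos⟩ : ℕ+))
          (fun v' : InfinitePlace F =>
            (⟨relLocalDegree F K (Sum.inl (τ v')), relLocalDegree_pos F K _⟩ : ℕ+)) v *
        ((τ v).mult : ℝ) =
      packetWeight (fun w' : InfinitePlace F => (⟨w'.mult, InfinitePlace.mult_pos⟩ : ℕ+)) (fun _ => 1) v *
        (v.mult : ℝ) := by
  rw [← relHaarWeight_inl_eq_packetWeight_rel_mul τ v, relHaarWeight_inl_eq F K (τ v), hτ v]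
  exact haarWeight_inl_eq_packetWeight_mul F v

/-! ### (c) `|A| ≥ 2`, `K = F_mod`: the archimedean portion weight BY NAME -/

variable (F)
variable (A : Type) [Fintype A] [DecidableEq A]

omit [Fintype A] [DecidableEq A] in
/-- Each factor of the archimedean portion weight is `[F_{w_α}:ℝ]/[F:ℚ]` at `w_α = packetInftyEquiv (π α)`.
[claim: Mochizuki2012, status: disputed] -/
theorem placeProbWeight_portion_infty (π : Portion F A RatPlace.infty) (α : A) :
    placeProbWeight F (π α).1 = ((packetInftyEquiv F (π α)).mult : ℝ) / Module.finrank ℚ F := by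
  generalize π α = v
  rcases v with ⟨w | w, h⟩
  · rfl
  · exact absurd h (ratPlaceBelow_inr_ne_infty F w)

/-- **(c) The archimedean portion weight IS Remark 3.1.1 (ii)'s normalized weight times the dimension of the
portion** (`K = F_mod`): for a tuple `π = (w_α)_α` of archimedean places of `F`,
`portionWeight F A ∞ π = ∏_α [F_{w_α}:ℝ]/[F:ℚ] = packetWeightTensor([F_·:ℝ], 1)(π)·∏_α [F_{w_α}:ℝ]` with abc-iut-L6-t4's
`packetWeightTensor degF degKF π = 1/((∏_α degKF(w_α))·Σ_{(w'_α)}∏_α degF(w'_α))` at `degF = [(F_mod)_·:ℝ]`, `degKF = 1`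
— since `Σ_{(w'_α)}∏_α[F_{w'_α}:ℝ] = [F:ℚ]^{|A|}`. The archimedean twin of d3's
`portionWeight_prime_eq_packetWeightTensor_mul`; `∏_α[F_{w_α}:ℝ] = dim_ℝ ⊗_{α,ℝ} F_{w_α}` is the factor by which the
dimension-normalised `μ^log` of the portion divides. [claim: Mochizuki2012, status: disputed] -/
theorem portionWeight_infty_eq_packetWeightTensor_mul (π : Portion F A RatPlace.infty) :
    portionWeight F A RatPlace.infty π =
      packetWeightTensor (fun w' : InfinitePlace F => (⟨w'.mult, InfinitePlace.mult_pos⟩ : ℕ+)) (fun _ => 1)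
          (fun α => packetInftyEquiv F (π α)) *
        ∏ α, ((packetInftyEquiv F (π α)).mult : ℝ) := by
  simp only [portionWeight, packetWeightTensor, placeProbWeight_portion_infty F A π, PNat.mk_coe, PNat.one_coe,
    Nat.cast_one, Finset.prod_const_one, one_mul, sum_prod_mult_eq_pow F A]
  rw [Finset.prod_div_distrib, Finset.prod_const, Finset.card_univ, one_div, inv_mul_eq_div]

/-! ### (d) `|A| ≥ 2`, `K ⊋ F_mod`: the archimedean portion weight of the RELATIVE `A`-packets BY NAME -/

include hτ in
/-- **(d) The `|A| ≥ 2` ARCHIMEDEAN JUNCTION at the relative genuine `A`-packets** (abc-iut-w5-d083's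
`relPortionDatum σ τ A ∞ π = ⊗_{α,ℝ} K_{τ(w_α)}`, weighted in `relCapsulePacketLogVolume` by the SAME
`portionWeight F A ∞ π`): for a tuple `π = (w_α)_α` of archimedean places of `F_mod` and a lift `τ` with
`(τ w)|_F = w`, `portionWeight F A ∞ π = packetWeightTensor([F_·:ℝ], [K_{τ(·)}:F_·])(π)·∏_α [K_{τ(w_α)}:ℝ]` —
abc-iut-L6-t4's `packetWeightTensor` at `degF = [(F_mod)_·:ℝ]` and the GENUINE relative degrees
`degKF(w) = [K_{τ w}:(F_mod)_w] ∈ {1,2}` (Remark 3.1.1 (ii)'s third display VERBATIM at `v_ℚ = ∞`, relative factors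
included) times the dimension `∏_α [K_{τ(w_α)}:ℝ] = dim_ℝ ⊗_{α,ℝ} K_{τ(w_α)}` that the packet-normalised, dimension-
averaged `μ^log` divides by: the factors `[K_{v̲_α}:(F_mod)_{v_α}]` cancel against `[K_{v̲_α}:ℝ] =
[K_{v̲_α}:F_{v_α}]·[F_{v_α}:ℝ]` (`relLocalDegree_inl_section_mul_mult`), exactly as at `p` in d083's
`portionWeight_prime_eq_packetWeightTensor_rel_mul`. Closes second-reader note INFO-2 on p421698.
[claim: Mochizuki2012, status: disputed] -/
theorem portionWeight_infty_eq_packetWeightTensor_rel_mul (π : Portion F A RatPlace.infty) :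
    portionWeight F A RatPlace.infty π =
      packetWeightTensor (fun w' : InfinitePlace F => (⟨w'.mult, InfinitePlace.mult_pos⟩ : ℕ+))
          (fun v' : InfinitePlace F =>
            (⟨relLocalDegree F K (Sum.inl (τ v')), relLocalDegree_pos F K _⟩ : ℕ+))
          (fun α => packetInftyEquiv F (π α)) *
        ∏ α, ((τ (packetInftyEquiv F (π α))).mult : ℝ) := by
  have hd : (Module.finrank ℚ F : ℝ) ≠ 0 := (FinDivisor.finrank_pos (F := F)).ne'
  have htower : ∀ α, ((τ (packetInftyEquiv F (π α))).mult : ℝ) =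
      (relLocalDegree F K (Sum.inl (τ (packetInftyEquiv F (π α)))) : ℝ) *
        ((packetInftyEquiv F (π α)).mult : ℝ) := by
    intro α
    exact_mod_cast (relLocalDegree_inl_section_mul_mult τ hτ (packetInftyEquiv F (π α))).symm
  have hP : (∏ α, (relLocalDegree F K (Sum.inl (τ (packetInftyEquiv F (π α)))) : ℝ)) ≠ 0 :=
    Finset.prod_ne_zero_iff.mpr fun α _ => by exact_mod_cast (relLocalDegree_pos F K _).ne'
  simp only [portionWeight, packetWeightTensor, placeProbWeight_portion_infty F A π, PNat.mk_coe, htower,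
    sum_prod_mult_eq_pow F A]
  rw [Finset.prod_div_distrib, Finset.prod_const, Finset.card_univ, Finset.prod_mul_distrib]
  field_simp

include hτ in
/-- Hence, portion by portion, the relative and the absolute archimedean readings agree:
`packetWeightTensor([F_·:ℝ], [K_{τ(·)}:F_·])(π)·∏_α[K_{τ(w_α)}:ℝ] = packetWeightTensor([F_·:ℝ], 1)(π)·∏_α[F_{w_α}:ℝ]`.
[claim: Mochizuki2012, status: disputed] -/
theorem packetWeightTensor_rel_mul_eq_packetWeightTensor_mul (π : Portion F A RatPlace.infty) :
    packetWeightTensor (fun w' : InfinitePlace F => (⟨w'.mult, InfinitePlace.mult_pos⟩ : ℕ+))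
          (fun v' : InfinitePlace F =>
            (⟨relLocalDegree F K (Sum.inl (τ v')), relLocalDegree_pos F K _⟩ : ℕ+))
          (fun α => packetInftyEquiv F (π α)) *
        ∏ α, ((τ (packetInftyEquiv F (π α))).mult : ℝ) =
      packetWeightTensor (fun w' : InfinitePlace F => (⟨w'.mult, InfinitePlace.mult_pos⟩ : ℕ+)) (fun _ => 1)
          (fun α => packetInftyEquiv F (π α)) *
        ∏ α, ((packetInftyEquiv F (π α)).mult : ℝ) := by
  rw [← portionWeight_infty_eq_packetWeightTensor_rel_mul F τ hτ A π,
    portionWeight_infty_eq_packetWeightTensor_mul F A π]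

/-! ### (e) `|A| = 1` at a finite `v_ℚ = p`, BY NAME (completing the table; the literal displays are d004's) -/

/-- **(e) `haarWeight F (inr v) = packetWeight(n, 1)(v)`** for `v | p`: d3's finite weight `1/[F:ℚ]` IS Remark 3.1.1
(ii)'s `1/([K_v:(F_mod)_v]·Σ_{w|p}[(F_mod)_w:ℚ_p])` with `K = F_mod` (abc-iut-L6-t4's `packetWeight` at d3's
`localDegreePNat`, `degKF = 1`; `Σ_{w|p} n_w = [F:ℚ]`, campaign-S `sum_localDegree`). No packet-normalisation factor
appears: the model's `log‖·‖_v` is the un-averaged Haar log-modulus of `F_v`. [claim: Mochizuki2012, status: disputed] -/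
theorem haarWeight_inr_eq_packetWeight (p : Nat.Primes) {v : HeightOneSpectrum (𝓞 F)}
    (hv : v ∈ placesOver F (p : ℕ)) :
    haarWeight F (Sum.inr v) = packetWeight (localDegreePNat F p) (fun _ => 1) ⟨v, hv⟩ := by
  haveI : Fact (p : ℕ).Prime := ⟨p.2⟩
  simp only [haarWeight_inr, packetWeight, localDegreePNat_coe, PNat.one_coe, Nat.cast_one, one_mul]
  rw [Finset.sum_coe_sort (placesOver F (p : ℕ)) (fun v => (localDegree F v : ℝ)), ← Nat.cast_sum,
    sum_localDegree F (p : ℕ)]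

/-- **(e') `relHaarWeight F K (inr (σ v)) = packetWeight(n, [K_{σ(·)}:F_·])(v)`** for `v | p` along a section `σ` of
the finite places: the relative finite weight `1/([K_{v̲}:F_v]·[F:ℚ])` IS abc-iut-L6-t4's `packetWeight` at
`degF = n` (d3's `localDegreePNat`) and the GENUINE `degKF = [K_{v̲}:(F_mod)_v]` (d083's `relLocalDegreePNat σ p`) —
abc-iut-w5-d004's literal `relHaarWeight_inr_eq_print` in t4's vocabulary. [claim: Mochizuki2012, status: disputed] -/
theorem relHaarWeight_inr_eq_packetWeight_rel (σ : PlaceSection F K) (p : Nat.Primes) {v : HeightOneSpectrum (𝓞 F)}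
    (hv : v ∈ placesOver F (p : ℕ)) :
    relHaarWeight F K (Sum.inr (σ.lift v)) =
      packetWeight (localDegreePNat F p) (relLocalDegreePNat σ p) ⟨v, hv⟩ := by
  haveI : Fact (p : ℕ).Prime := ⟨p.2⟩
  simp only [relHaarWeight_inr, packetWeight, localDegreePNat_coe, relLocalDegreePNat_coe]
  rw [Finset.sum_coe_sort (placesOver F (p : ℕ)) (fun v => (localDegree F v : ℝ)), ← Nat.cast_sum,
    sum_localDegree F (p : ℕ)]

end Literature.IUT.LogThetaLattice

end
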